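import Summits.CriticalPhenomena.PercolationContinuityZ3.Theorems.PercNearOneGluingNoHeavyQuantLongTailHub
import HarnessLib

/-!
# QUANT lane R8, T-DEC: the long-tail sub-floor hub is SDEC for ALL gates `γᵢ ≥ 1/2` (width `2K ≤ lo·j`) — the count factor
# (census-1 gen 31; strengthens `…QuantLongTailHub.sdec_sHub_long`, which needs `γᵢ ≥ 2/3`)

builds on p205010 (kernel theorem, internal audit signed; external expert review pending)

Support file (`--supports stmt-CriticalPhenomena-4575`), QUANT lane seat prim-quant-census-1 (gen 31); memo
`run/shared/lean/prim/quant/prim-quant-census-1/g31/HUB-GENERAL-G31.md` §0 (7)(f).  Theorems only, standard axioms, no sorries.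

THE POINT.  With gates in `[1/2, 2/3)` the odds may be `1`, and the bound `u_{t*−s} ≥ ω^r u_s` alone is too weak (memo §0 (7), code/exp18: hundreds
of failures per width); the COUNT FACTOR `C(j−s, r)/C(s+r, r) = Π_{i≤r} (s+i+d)/(s+i) ≥ ((τ+d)/τ)^r` (`τ = t*−s = s+r`, `d = j − t* ≥ 1`;
`choose_ratio_pow`) repairs it (exp18: 0 failures at every width `lo·j ≥ 2K`).  Dichotomy: if `τ < d` the count factor exceeds `2^r`; if `τ ≥ d`
then `Λ = Σγᵢ > t*` makes the mean of the `j−s` smallest gates exceed `τ/(τ+d) ≥ 1/2`, so binomial extremality (`sHub_routeBound_nearOne` with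
`c = (Λ−s)/(j−s)`) gives odds `≥ τ/d` and `u_{t*−s} ≥ ((τ+d)/τ)^r (τ/d)^r u_s = ((j−s)/d)^r u_s ≥ 2^r u_s`.  Either way `B ≥ 2^r ≥ max(4, r)`, and
`x(1+B) ≤ B ⟸ x/(1−x) ≤ (3lo+2K)/K ≤ 4` (`longTail_floor_part₂`, for `c ≤ 2/3`), `ρ(1+B) ≤ B` as before.  The case `(x(lo+K)−lo)/K ≥ 2/3`
(then every gate is `≥ 2/3`) is `sdec_sHub_long` itself.
RESULT (`sdec_sHub_long_half`): `lo < K`, `3lo ≤ 2K`, gates `γᵢ ∈ [1/2, 1)` with `x(lo+K) ≤ lo + Kγᵢ`, `0 < x`, `2K ≤ lo·j` ⟹ `SDEC x ((lo+K)j) (sHub lo K P)`.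

HONEST STATUS.  Hub-level; the window `K < lo·j < 2K`, the smallest widths and the long-tail forest expansion remain open (memo §3 item 2).
`SiblingStep`, `GluedDominated'`, `SDECConvClosed`, `FarTreeRow` OPEN; RATE class (log\*) / honest sentence of `run/shared/lean/prim/quant/README.md`
unchanged.  [this work].  Nothing here is cited as a published result.  The gluing rows served [cite: KozmaNitzan2024, Conjecture 3 (p. 15)]; product
measure [cite: Grimmett1999, §1.3 p. 10].
-/

noncomputable section

open scoped BigOperators

namespace Summit.CriticalPhenomena.PercolationContinuityZ3.Theorems
namespace Quant
namespace LawDec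

open Finset

/-- **the count factor**: `C(s+r, r)·(s+r+d)^r ≤ C(s+r+d, r)·(s+r)^r`, i.e. `C(τ+d, r)/C(τ, r) ≥ ((τ+d)/τ)^r` for `τ = s + r`. [this work] -/
theorem choose_ratio_pow (s d : ℕ) : ∀ r : ℕ,
    (((s + r).choose r : ℕ) : ℝ) * (((s + r + d : ℕ) : ℝ)) ^ r ≤ (((s + r + d).choose r : ℕ) : ℝ) * (((s + r : ℕ) : ℝ)) ^ r
  | 0 => by simp
  | r + 1 => by
    have IH := choose_ratio_pow s d r
    -- Pascal-type identities `(r+1)·C(τ+1, r+1) = (τ+1)·C(τ, r)`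
    have e1 : ((r + 1 : ℕ) : ℝ) * (((s + (r + 1)).choose (r + 1) : ℕ) : ℝ) = ((s + r + 1 : ℕ) : ℝ) * (((s + r).choose r : ℕ) : ℝ) := by
      have h := Nat.add_one_mul_choose_eq (s + r) r
      rw [show s + (r + 1) = s + r + 1 by ring]
      rw [mul_comm ((s + r + 1).choose (r + 1))] at h
      exact_mod_cast h.symm
    have e2 : ((r + 1 : ℕ) : ℝ) * (((s + (r + 1) + d).choose (r + 1) : ℕ) : ℝ)
        = ((s + r + d + 1 : ℕ) : ℝ) * (((s + r + d).choose r : ℕ) : ℝ) := by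
      have h := Nat.add_one_mul_choose_eq (s + r + d) r
      rw [show s + (r + 1) + d = s + r + d + 1 by ring]
      rw [mul_comm ((s + r + d + 1).choose (r + 1))] at h
      exact_mod_cast h.symm
    have hr1 : (0 : ℝ) < ((r + 1 : ℕ) : ℝ) := by positivity
    -- reduce to `C(τ, r)(τ+1+d)^r ≤ C(τ+d, r)(τ+1)^r`
    set τ : ℝ := ((s + r : ℕ) : ℝ) with hτ
    have hτ0 : 0 ≤ τ := by positivity
    have hd0 : (0 : ℝ) ≤ d := by positivity
    have eA : (((s + (r + 1) + d : ℕ) : ℝ)) = τ + 1 + d := by rw [hτ]; push_cast; ring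
    have eB : (((s + (r + 1) : ℕ) : ℝ)) = τ + 1 := by rw [hτ]; push_cast; ring
    have eC : (((s + r + d : ℕ) : ℝ)) = τ + d := by rw [hτ]; push_cast; ring
    have eD : ((s + r + 1 : ℕ) : ℝ) = τ + 1 := by rw [hτ]; push_cast; ring
    have eE : ((s + r + d + 1 : ℕ) : ℝ) = τ + 1 + d := by rw [hτ]; push_cast; ring
    rw [eC] at IH
    rw [eA, eB]
    -- the key monotonicity `(τ+1+d)·τ ≤ (τ+d)(τ+1)` lifted to powers
    have hmono : (τ + 1 + d) * τ ≤ (τ + d) * (τ + 1) := by nlinarith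
    have hpow : ((τ + 1 + d) * τ) ^ r ≤ ((τ + d) * (τ + 1)) ^ r :=
      pow_le_pow_left₀ (by positivity) hmono r
    rw [mul_pow, mul_pow] at hpow
    have hCτ : 0 ≤ (((s + r).choose r : ℕ) : ℝ) := by positivity
    have hCd : 0 ≤ (((s + r + d).choose r : ℕ) : ℝ) := by positivity
    -- `C(τ,r)(τ+1+d)^r τ^r ≤ C(τ,r)(τ+d)^r(τ+1)^r ≤ C(τ+d,r) τ^r (τ+1)^r`
    have step : (((s + r).choose r : ℕ) : ℝ) * (τ + 1 + d) ^ r * τ ^ r ≤ (((s + r + d).choose r : ℕ) : ℝ) * (τ + 1) ^ r * τ ^ r := by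
      have h1 : (((s + r).choose r : ℕ) : ℝ) * ((τ + 1 + d) ^ r * τ ^ r) ≤ (((s + r).choose r : ℕ) : ℝ) * ((τ + d) ^ r * (τ + 1) ^ r) :=
        mul_le_mul_of_nonneg_left hpow hCτ
      have h2 : (((s + r).choose r : ℕ) : ℝ) * (τ + d) ^ r * (τ + 1) ^ r ≤ (((s + r + d).choose r : ℕ) : ℝ) * τ ^ r * (τ + 1) ^ r :=
        mul_le_mul_of_nonneg_right IH (by positivity)
      nlinarith
    -- cancel `τ^r` (if `τ = 0` then `r = 0` and the claim is direct)
    have main : (((s + r).choose r : ℕ) : ℝ) * (τ + 1 + d) ^ r ≤ (((s + r + d).choose r : ℕ) : ℝ) * (τ + 1) ^ r := by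
      rcases Nat.eq_zero_or_pos (s + r) with h0 | hpos
      · have hr0 : r = 0 := by omega
        have hs0 : s = 0 := by omega
        subst hr0; subst hs0; simp
      · have hτpos : 0 < τ ^ r := by
          have : (0 : ℝ) < τ := by rw [hτ]; exact_mod_cast hpos
          positivity
        exact le_of_mul_le_mul_right step hτpos
    -- multiply back by `(τ+1)`, `(τ+1+d)` and use the identities
    have goal' : ((r + 1 : ℕ) : ℝ) * ((((s + (r + 1)).choose (r + 1) : ℕ) : ℝ) * (τ + 1 + d) ^ (r + 1))
        ≤ ((r + 1 : ℕ) : ℝ) * ((((s + (r + 1) + d).choose (r + 1) : ℕ) : ℝ) * (τ + 1) ^ (r + 1)) := by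
      have l1 : ((r + 1 : ℕ) : ℝ) * ((((s + (r + 1)).choose (r + 1) : ℕ) : ℝ) * (τ + 1 + d) ^ (r + 1))
          = (τ + 1) * (τ + 1 + d) * ((((s + r).choose r : ℕ) : ℝ) * (τ + 1 + d) ^ r) := by
        rw [← mul_assoc, e1, eD]; ring
      have l2 : ((r + 1 : ℕ) : ℝ) * ((((s + (r + 1) + d).choose (r + 1) : ℕ) : ℝ) * (τ + 1) ^ (r + 1))
          = (τ + 1) * (τ + 1 + d) * ((((s + r + d).choose r : ℕ) : ℝ) * (τ + 1) ^ r) := by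
        rw [← mul_assoc, e2, eE]; ring
      rw [l1, l2]
      exact mul_le_mul_of_nonneg_left main (by positivity)
    exact le_of_mul_le_mul_left goal' hr1

/-- floor part when the floor is moderate: `3lo ≤ 2K`, `c ≤ 2/3`, `x(lo+K) ≤ lo + Kc`, `B ≥ 4` ⟹ `x(1+B) ≤ B`
(`x/(1−x) ≤ (3lo+2K)/K ≤ 4`). [this work] -/
theorem longTail_floor_part₂ (lo K x c B : ℝ) (hlo : 0 ≤ lo) (hK : 0 < K) (h32 : 3 * lo ≤ 2 * K) (hc : c ≤ 2 / 3)
    (hx : x * (lo + K) ≤ lo + K * c) (hB : 4 ≤ B) : x * (1 + B) ≤ B := by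
  have hx' : x * (lo + K) ≤ lo + 2 * K / 3 := by nlinarith
  have hloK : 0 < lo + K := by linarith
  -- `(lo + 2K/3)(1+B) ≤ B(lo+K)` since `BK/3 ≥ 4K/3 ≥ lo + 2K/3`
  have h2 : (lo + 2 * K / 3) * (1 + B) ≤ B * (lo + K) := by nlinarith
  have h3 : x * (lo + K) * (1 + B) ≤ B * (lo + K) := by nlinarith
  have h4 : x * (1 + B) * (lo + K) ≤ B * (lo + K) := by linarith [h3]
  exact le_of_mul_le_mul_right h4 hloK

set_option maxHeartbeats 400000 in
/-- **the long-tail sub-floor hub is SDEC for all gates `≥ 1/2`** (`lo < K`, `3lo ≤ 2K`, width `2K ≤ lo·j`, gates `γᵢ ∈ [1/2,1)` with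
`x(lo+K) ≤ lo + Kγᵢ`, `0 < x`): `SDEC x ((lo+K)j) (sHub lo K P)`. [this work] -/
theorem sdec_sHub_long_half (lo K : ℕ) (hloK : lo < K) (h32 : 3 * lo ≤ 2 * K) (x : ℝ) (hx0 : 0 < x) (P : List ℝ)
    (hj : 2 * K ≤ lo * P.length) (hP : ∀ γ ∈ P, 1 / 2 ≤ γ ∧ γ < 1 ∧ x * ((lo : ℝ) + K) ≤ lo + K * γ) :
    SDEC x ((lo + K) * P.length) (sHub lo K P) := by
  have hK : 0 < K := lt_of_le_of_lt (Nat.zero_le lo) hloK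
  have hK0 : (0 : ℝ) < K := by exact_mod_cast hK
  -- Branch 1: a high floor forces every gate `≥ 2/3`
  by_cases hcx23 : 2 / 3 ≤ (x * ((lo : ℝ) + K) - lo) / K
  · refine sdec_sHub_long lo K hloK h32 x hx0 P hj (fun γ hγ => ⟨?_, (hP γ hγ).2.1, (hP γ hγ).2.2⟩)
    have : (x * ((lo : ℝ) + K) - lo) / K ≤ γ := by rw [div_le_iff₀ hK0]; linarith [(hP γ hγ).2.2]
    linarith
  push Not at hcx23
  have hx23 : x * ((lo : ℝ) + K) ≤ lo + K * (2 / 3) := by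
    have := hcx23; rw [div_lt_iff₀ hK0] at this; linarith
  -- Branch 2: the setup of `sdec_sHub_long`
  have hjK : K < lo * P.length := by omega
  have hlo0 : (0 : ℝ) ≤ lo := Nat.cast_nonneg lo
  have h32R : 3 * (lo : ℝ) ≤ 2 * K := by exact_mod_cast h32
  have hjKR : 2 * (K : ℝ) ≤ (lo : ℝ) * P.length := by exact_mod_cast hj
  have hPne : P ≠ [] := by
    intro h; rw [h] at hjK; simp at hjK
  have hPh : ∀ γ ∈ P, 1 / 2 ≤ γ ∧ γ < 1 := fun γ hγ => ⟨(hP γ hγ).1, (hP γ hγ).2.1⟩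
  have hP01 : ∀ γ ∈ P, 0 ≤ γ ∧ γ ≤ 1 := fun γ hγ => ⟨by linarith [(hP γ hγ).1], (hP γ hγ).2.1.le⟩
  obtain ⟨h0, hM, h1, hmean⟩ := sHub_laws lo K P hP01
  rw [sum_map_affine] at hmean
  obtain ⟨γ₁, hγ₁⟩ := List.exists_mem_of_ne_nil P hPne
  have hx1 : x < 1 := by
    have h := (hP γ₁ hγ₁).2.2
    have hγ1 : (lo : ℝ) + K * γ₁ < lo + K := by nlinarith [(hP γ₁ hγ₁).2.1]
    have hloK0 : (0 : ℝ) < lo + K := by linarith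
    by_contra hx
    push Not at hx
    have : (lo : ℝ) + K ≤ x * (lo + K) := by nlinarith
    linarith
  have hta : x * (((lo + K) * P.length : ℕ) : ℝ) ≤ (lo : ℝ) * P.length + K * P.sum := by
    have hs := le_sum_of_forall_le ((x * ((lo : ℝ) + K) - lo) / K) P (fun γ hγ => by
      rw [div_le_iff₀ hK0]; linarith [(hP γ hγ).2.2])
    have e : (x * ((lo : ℝ) + K) - lo) / K * (P.length : ℝ) * K = (x * ((lo : ℝ) + K) - lo) * P.length := by
      field_simp
    have hs' : (x * ((lo : ℝ) + K) - lo) * (P.length : ℝ) ≤ K * P.sum := by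
      have := mul_le_mul_of_nonneg_right hs hK0.le
      rw [e] at this; linarith
    push_cast
    have e2 : x * (((lo : ℝ) + K) * P.length) = (x * ((lo : ℝ) + K) - lo) * P.length + lo * P.length := by ring
    rw [e2]; linarith
  have hΛj : P.sum < P.length := (sum_bounds_nearOne P hPh).2 hPne
  have hΛ0 : (P.length : ℝ) / 2 ≤ P.sum := (sum_bounds_nearOne P hPh).1
  have hT0pos : 0 < (lo : ℝ) * P.length + K * P.sum := by
    have hj0 : (0 : ℝ) < P.length := by
      have : 0 < P.length := List.length_pos_iff.mpr hPne
      exact_mod_cast this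
    have : (0 : ℝ) < K * P.sum := mul_pos hK0 (by linarith)
    have : (0 : ℝ) ≤ (lo : ℝ) * P.length := mul_nonneg hlo0 hj0.le
    linarith
  have hsupp : ∀ h, sHub lo K P h ≠ 0 → ∃ s, h = lo * P.length + K * s := by
    intro h hh
    obtain ⟨s, hs, _⟩ := (sHub_struct lo K hloK 0 le_rfl P (fun γ hγ => ⟨(hP01 γ hγ).1, (hP01 γ hγ).2, by
      rw [zero_mul]; exact (hP01 γ hγ).1⟩)).1 h hh
    exact ⟨s, hs⟩
  refine sdec_farthestNear lo K P.length x ((lo : ℝ) * P.length + K * P.sum) (sHub lo K P) hK hjK hx0 hx1 h0 hM h1 hmean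
    hT0pos hta hsupp ?_
  intro T hTpos hTle t s hKt hTc h2s hlT _hμl
  set r : ℕ := t - 2 * s with hr
  have hts : t - s = s + r := by omega
  have hrR : ((r : ℕ) : ℝ) = (t : ℝ) - 2 * s := by
    rw [hr, Nat.cast_sub h2s.le]; push_cast; ring
  have hr2 : 2 ≤ r := by
    have h : (lo : ℝ) * P.length < K * ((r : ℝ) + 1) := by rw [hrR]; linarith
    have h' : (K : ℝ) * 2 < K * ((r : ℝ) + 1) := by linarith [lt_of_le_of_lt hjKR h]
    have h'' : (2 : ℝ) < (r : ℝ) + 1 := lt_of_mul_lt_mul_left h' hK0.le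
    have : (1 : ℝ) < r := by linarith
    exact_mod_cast this
  have hr2R : (2 : ℝ) ≤ r := by exact_mod_cast hr2
  have hr0 : (0 : ℝ) < r := by linarith
  have hD : T - 2 * ((lo : ℝ) * P.length + K * s) ≤ K * ((r : ℝ) - 1) := by
    have : T - 2 * ((lo : ℝ) * P.length + K * s) ≤ K * ((r : ℝ) + 1) - lo * P.length := by rw [hrR]; linarith
    linarith
  have hDpos : 0 < T - 2 * ((lo : ℝ) * P.length + K * s) := by linarith
  have hΛt : (t : ℝ) < P.sum := by
    have h1' : (K : ℝ) * t < K * P.sum := by linarith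
    exact lt_of_mul_lt_mul_left h1' hK0.le
  have htj : t < P.length := by
    have : (t : ℝ) < P.length := by linarith
    exact_mod_cast this
  have hsj : s < P.length := by omega
  -- `d = j − t ≥ 1`, `n = j − s = τ + d`, `τ = s + r = t − s`
  obtain ⟨d, hd⟩ : ∃ d : ℕ, P.length = t + d := ⟨P.length - t, by omega⟩
  have hd1 : 1 ≤ d := by omega
  have hn : P.length - s = s + r + d := by omega
  have hτR : (((s + r : ℕ)) : ℝ) = (t : ℝ) - s := by push_cast; rw [hrR]; ring
  have hτ2 : (2 : ℝ) ≤ ((s + r : ℕ) : ℝ) := by push_cast; linarith [Nat.cast_nonneg (α := ℝ) s]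
  have hτpos : (0 : ℝ) < ((s + r : ℕ) : ℝ) := by linarith
  have hd0 : (0 : ℝ) < d := by exact_mod_cast hd1
  have hu0 : 0 ≤ sHub lo K P (lo * P.length + K * s) := h0 _
  have huh0 : 0 ≤ sHub lo K P (lo * P.length + K * (s + r)) := h0 _
  have eCsym : (s + r).choose s = (s + r).choose r := Nat.choose_symm_add
  have hCpos : (0 : ℝ) < (((s + r).choose r : ℕ) : ℝ) := by exact_mod_cast Nat.choose_pos (by omega)
  have hR := choose_ratio_pow s d r
  -- the route bound `2^r · u_s ≤ u_{s+r}` in both sub-cases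
  have hb : (2 : ℝ) ^ r * sHub lo K P (lo * P.length + K * s) ≤ sHub lo K P (lo * P.length + K * (s + r)) := by
    by_cases hτd : s + r < d
    · -- (2a) `τ < d`: the count factor alone exceeds `2^r`
      set c : ℝ := max (1 / 2) ((x * ((lo : ℝ) + K) - lo) / K) with hc
      have hc12 : 1 / 2 ≤ c := le_max_left _ _
      have hc1 : c < 1 := by rw [hc, max_lt_iff]; exact ⟨by norm_num, by linarith⟩
      have hcP : ∀ γ ∈ P, c ≤ γ := fun γ hγ => by
        rw [hc, max_le_iff]; refine ⟨(hP γ hγ).1, ?_⟩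
        rw [div_le_iff₀ hK0]; linarith [(hP γ hγ).2.2]
      have hRB := sHub_routeBound_nearOne' lo K hloK P hPh s r hsj c hc12 hc1 hcP
      rw [hn, eCsym] at hRB
      have h1c : 0 < 1 - c := by linarith
      have hω1 : 1 ≤ c / (1 - c) := by rw [le_div_iff₀ h1c]; linarith
      have hωr : 1 ≤ (c / (1 - c)) ^ r := one_le_pow₀ hω1
      -- `C(τ,r)·2^r ≤ C(τ+d,r)` from `choose_ratio_pow` and `2τ ≤ τ + d`
      have h2τ : 2 * (((s + r : ℕ)) : ℝ) ≤ ((s + r + d : ℕ) : ℝ) := by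
        have : s + r + 1 ≤ d := hτd
        push_cast; have : ((s : ℝ) + r) + 1 ≤ d := by exact_mod_cast this
        linarith
      have hpow : (2 * (((s + r : ℕ)) : ℝ)) ^ r ≤ (((s + r + d : ℕ)) : ℝ) ^ r := pow_le_pow_left₀ (by positivity) h2τ r
      rw [mul_pow] at hpow
      have hC2 : (((s + r).choose r : ℕ) : ℝ) * (2 : ℝ) ^ r ≤ (((s + r + d).choose r : ℕ) : ℝ) := by
        have hτr : (0 : ℝ) < (((s + r : ℕ)) : ℝ) ^ r := by positivity
        have hA := mul_le_mul_of_nonneg_left hpow (Nat.cast_nonneg ((s + r).choose r) : (0 : ℝ) ≤ _)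
        have : (((s + r).choose r : ℕ) : ℝ) * (2 : ℝ) ^ r * (((s + r : ℕ)) : ℝ) ^ r
            ≤ (((s + r + d).choose r : ℕ) : ℝ) * (((s + r : ℕ)) : ℝ) ^ r := by
          rw [mul_assoc]; exact hA.trans hR
        exact le_of_mul_le_mul_right this hτr
      -- chain
      have hCd0 : 0 ≤ (((s + r + d).choose r : ℕ) : ℝ) := by positivity
      have h4 : (((s + r).choose r : ℕ) : ℝ) * ((2 : ℝ) ^ r * sHub lo K P (lo * P.length + K * s))
          ≤ (((s + r).choose r : ℕ) : ℝ) * sHub lo K P (lo * P.length + K * (s + r)) :=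
        calc (((s + r).choose r : ℕ) : ℝ) * ((2 : ℝ) ^ r * sHub lo K P (lo * P.length + K * s))
            = ((((s + r).choose r : ℕ) : ℝ) * (2 : ℝ) ^ r) * sHub lo K P (lo * P.length + K * s) := by ring
          _ ≤ (((s + r + d).choose r : ℕ) : ℝ) * sHub lo K P (lo * P.length + K * s) := mul_le_mul_of_nonneg_right hC2 hu0
          _ ≤ ((((s + r + d).choose r : ℕ) : ℝ) * (c / (1 - c)) ^ r) * sHub lo K P (lo * P.length + K * s) :=
              mul_le_mul_of_nonneg_right (le_mul_of_one_le_right hCd0 hωr) hu0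
          _ = sHub lo K P (lo * P.length + K * s) * ((((s + r + d).choose r : ℕ) : ℝ) * (c / (1 - c)) ^ r) := by ring
          _ ≤ (((s + r).choose r : ℕ) : ℝ) * sHub lo K P (lo * P.length + K * (s + r)) := hRB
      exact le_of_mul_le_mul_left h4 hCpos
    · -- (2b) `τ ≥ d`: the mean of the `j − s` smallest gates exceeds `τ/(τ+d) ≥ 1/2`
      push Not at hτd
      set c : ℝ := (P.sum - s) / (((P.length - s : ℕ)) : ℝ) with hc
      have hnR : (((P.length - s : ℕ)) : ℝ) = (((s + r : ℕ)) : ℝ) + d := by rw [hn]; push_cast; ring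
      have hnpos : (0 : ℝ) < (((P.length - s : ℕ)) : ℝ) := by rw [hnR]; linarith
      have hcn : c * (((P.length - s : ℕ)) : ℝ) = P.sum - s := by rw [hc]; field_simp
      have hΛτ : (((s + r : ℕ)) : ℝ) < P.sum - s := by rw [hτR]; linarith
      have hdτ : (d : ℝ) ≤ (((s + r : ℕ)) : ℝ) := by exact_mod_cast hτd
      have hc12 : 1 / 2 ≤ c := by
        rw [hc, le_div_iff₀ hnpos, hnR]; linarith
      have hc1 : c < 1 := by
        rw [hc, div_lt_iff₀ hnpos]
        have : (((P.length - s : ℕ)) : ℝ) = (P.length : ℝ) - s := by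
          rw [Nat.cast_sub hsj.le]
        rw [this]; linarith
      have hcs : c * (((P.length - s : ℕ)) : ℝ) ≤ P.sum - s := hcn.le
      have hRB := sHub_routeBound_nearOne lo K hloK P hPh s r hsj c hc12 hc1 hcs
      rw [hn, eCsym] at hRB
      have h1c : 0 < 1 - c := by linarith
      set ω : ℝ := c / (1 - c) with hω
      have hω0 : 0 ≤ ω := div_nonneg (by linarith) h1c.le
      -- `τ ≤ ω·d`
      have hωd : (((s + r : ℕ)) : ℝ) ≤ ω * d := by
        rw [hω, div_mul_eq_mul_div, le_div_iff₀ h1c]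
        have : c * ((((s + r : ℕ)) : ℝ) + d) = P.sum - s := by rw [← hnR]; exact hcn
        rw [mul_add] at this
        linarith
      have hpow1 : (((s + r : ℕ)) : ℝ) ^ r ≤ (ω * d) ^ r := pow_le_pow_left₀ hτpos.le hωd r
      rw [mul_pow] at hpow1
      -- `(2d)^r ≤ n^r`
      have h2d : 2 * (d : ℝ) ≤ ((s + r + d : ℕ) : ℝ) := by push_cast; push_cast at hdτ; linarith
      have hpow2 : (2 * (d : ℝ)) ^ r ≤ (((s + r + d : ℕ)) : ℝ) ^ r := pow_le_pow_left₀ (by positivity) h2d r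
      rw [mul_pow] at hpow2
      -- `C(τ,r)·2^r·d^r ≤ C(τ,r)·n^r ≤ C(n,r)·τ^r ≤ C(n,r)·ω^r·d^r`
      have hdr : (0 : ℝ) < (d : ℝ) ^ r := by positivity
      have hC2 : (((s + r).choose r : ℕ) : ℝ) * (2 : ℝ) ^ r ≤ (((s + r + d).choose r : ℕ) : ℝ) * ω ^ r := by
        have : (((s + r).choose r : ℕ) : ℝ) * (2 : ℝ) ^ r * (d : ℝ) ^ r ≤ (((s + r + d).choose r : ℕ) : ℝ) * ω ^ r * (d : ℝ) ^ r :=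
          calc (((s + r).choose r : ℕ) : ℝ) * (2 : ℝ) ^ r * (d : ℝ) ^ r
              = (((s + r).choose r : ℕ) : ℝ) * ((2 : ℝ) ^ r * (d : ℝ) ^ r) := by ring
            _ ≤ (((s + r).choose r : ℕ) : ℝ) * (((s + r + d : ℕ)) : ℝ) ^ r := mul_le_mul_of_nonneg_left hpow2 (by positivity)
            _ ≤ (((s + r + d).choose r : ℕ) : ℝ) * (((s + r : ℕ)) : ℝ) ^ r := hR
            _ ≤ (((s + r + d).choose r : ℕ) : ℝ) * (ω ^ r * (d : ℝ) ^ r) := mul_le_mul_of_nonneg_left hpow1 (by positivity)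
            _ = (((s + r + d).choose r : ℕ) : ℝ) * ω ^ r * (d : ℝ) ^ r := by ring
        exact le_of_mul_le_mul_right this hdr
      have h4 : (((s + r).choose r : ℕ) : ℝ) * ((2 : ℝ) ^ r * sHub lo K P (lo * P.length + K * s))
          ≤ (((s + r).choose r : ℕ) : ℝ) * sHub lo K P (lo * P.length + K * (s + r)) :=
        calc (((s + r).choose r : ℕ) : ℝ) * ((2 : ℝ) ^ r * sHub lo K P (lo * P.length + K * s))
            = ((((s + r).choose r : ℕ) : ℝ) * (2 : ℝ) ^ r) * sHub lo K P (lo * P.length + K * s) := by ring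
          _ ≤ ((((s + r + d).choose r : ℕ) : ℝ) * ω ^ r) * sHub lo K P (lo * P.length + K * s) := mul_le_mul_of_nonneg_right hC2 hu0
          _ = sHub lo K P (lo * P.length + K * s) * ((((s + r + d).choose r : ℕ) : ℝ) * ω ^ r) := by ring
          _ ≤ (((s + r).choose r : ℕ) : ℝ) * sHub lo K P (lo * P.length + K * (s + r)) := hRB
      exact le_of_mul_le_mul_left h4 hCpos
  -- floor and credit parts with `B = 2^r ≥ max(4, r)`
  have hB4 : (4 : ℝ) ≤ (2 : ℝ) ^ r := by
    have : (2 : ℝ) ^ 2 ≤ 2 ^ r := pow_le_pow_right₀ (by norm_num) hr2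
    norm_num at this; exact this
  have hBr : (r : ℝ) ≤ (2 : ℝ) ^ r := by exact_mod_cast (Nat.lt_two_pow_self).le
  have hxB : x * (1 + (2 : ℝ) ^ r) ≤ 2 ^ r := longTail_floor_part₂ lo K x (2 / 3) _ hlo0 hK0 h32R le_rfl hx23 hB4
  have hρ : (T - 2 * ((lo : ℝ) * P.length + K * s)) / ((K : ℝ) * (r : ℝ)) * (1 + (2 : ℝ) ^ r) ≤ 2 ^ r :=
    longTail_credit_part hK0 hr0 hD hBr
  rw [hts, max_mul_of_nonneg _ _ (add_nonneg hu0 huh0)]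
  exact max_le (cap_of_ratio (by positivity) hxB hu0 hb) (cap_of_ratio (by positivity) hρ hu0 hb)

end LawDec
end Quant
end Summit.CriticalPhenomena.PercolationContinuityZ3.Theorems
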